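/-
Copyright (c) 2026. All rights reserved.
Released under Apache 2.0 license as described in the file LICENSE.
Authors: abc-iut cell, wave-2 seat abc-iut-L3-t11 (proof-only; G10 rung 3b, row «hnobp PRODUCER-CONSUMER»:
total estrangement forbids a nontrivial subgroup fixing a compatible system of branch-pairs).
-/
import Literature.AnabelianGeometry.SemiGraphs.TemperedVerticial
import HarnessLib

/-!
# [SemiAnbd] Thm 3.7 (iii), the estrangement step: no nontrivial subgroup fixes a compatible system of branch-pairs

Mochizuki, *Semi-graphs of anabelioids*, Publ. RIMS **42** (2006) [MochizukiSemiAnbd2006], proof of Thm 3.7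
(iii), p. 41, with the author's *Comments* (2020), (6)(b): a compatible system of `H`-fixed subjoints of the
finite levels `G_j` "implies [cf. Remark 2.2.1] that `H` is contained in some conjugate in `π̂₁(G)` of some
`π̂₁(G_v)`, and, moreover, … for two distinct branches `b`, `b'` abutting to `v` of edges `e`, `e'` [where `e`
is not necessarily distinct from `e'`], in the intersection of the images of `π₁(G_e)`, `π₁(G_{e'})`, via `b`,
`b'`. But since `G` is assumed to be totally estranged, we thus conclude that `H` is trivial".

This PROOF-ONLY file is the CONSUMER half of that step, in abc-iut-L3-t2's local presentation
(`ProfiniteSemiGraph`, `TemperedPiChart`, `Thm37Hypotheses.isTotallyEstranged` = for two distinct branch-cosets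
`(b, xΠ_b) ≠ (b', x'Π_{b'})` at `v`, `Π_b ∩ (x⁻¹x')·Π_{b'}·(x⁻¹x')⁻¹ = 1` in `Π_v`): GIVEN the branch-level
Remark 2.2.1 identification (I4) `stabBranchPair` for the finite levels of the chart — the pointwise stabiliser
of a compatible system `(w_i; β_i ≠ β'_i)` of a vertex with two distinct abutting branches lies in
`ψ(x·Π_b·x⁻¹) ∩ ψ(x'·Π_{b'}·x'⁻¹)` for one injective `ψ : Π_v → π₁^temp` and two distinct branch-cosets at `v`
(rung 1 / the §2 dictionary) — it PROVES the hypothesis `hnobp` of `SemiGraph.hstar_of_noFixedBranchPairSystem`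
(`TreeSystemStarCondition.lean`): a subgroup `C` fixing such a system is trivial
(`noFixedBranchPairSystem_of_isTotallyEstranged`). The finite-level data enter as explicit binders
(`level`, `levelAct`, `levelTrans`), to be instantiated from the `VerticialLevelData` of the chart. No
definitions.
-/

namespace Literature.AnabelianGeometry.SemiGraphs

namespace ProfiniteSemiGraph

open CategoryTheory Topology

universe v u

variable {𝒢 : ProfiniteSemiGraph.{u}}

/-- **Two distinct branch-cosets meet trivially under an injective homomorphism** (the group theory of
the estrangement step): if `Π_b ∩ g·Π_{b'}·g⁻¹ = 1` in `Π_v` with `g = x⁻¹x'`, and `ψ : Π_v → Π` is injective,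
then `ψ(x·Π_b·x⁻¹) ∩ ψ(x'·Π_{b'}·x'⁻¹) = 1` in `Π`. [cite: MochizukiSemiAnbd2006, Thm. 3.7(iii) p.41] -/
theorem map_conj_inf_map_conj_eq_bot {V P : Type u} [Group V] [Group P] (ψ : V →* P)
    (hψ : Function.Injective ψ) (A B : Subgroup V) (x x' : V)
    (h : A ⊓ B.map (MulAut.conj (x⁻¹ * x')).toMonoidHom = ⊥) :
    (A.map (MulAut.conj x).toMonoidHom).map ψ ⊓ (B.map (MulAut.conj x').toMonoidHom).map ψ = ⊥ := by
  rw [eq_bot_iff]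
  rintro g ⟨⟨a₁, ha₁, rfl⟩, ⟨a₂, ha₂, heq⟩⟩
  have h12 : a₂ = a₁ := hψ heq
  subst h12
  obtain ⟨a₀, ha₀, rfl⟩ := ha₁
  obtain ⟨b₀, hb₀, hb₀eq⟩ := ha₂
  simp only [MulEquiv.coe_toMonoidHom, MulAut.conj_apply] at hb₀eq
  -- `a₀ = (x⁻¹ x') b₀ (x⁻¹ x')⁻¹ ∈ A ∩ conj(B) = 1`
  have ha₀' : a₀ ∈ B.map (MulAut.conj (x⁻¹ * x')).toMonoidHom := by
    refine ⟨b₀, hb₀, ?_⟩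
    simp only [MulEquiv.coe_toMonoidHom, MulAut.conj_apply]
    have : a₀ = x⁻¹ * (x' * b₀ * x'⁻¹) * x := by
      rw [hb₀eq]; simp only [mul_assoc, inv_mul_cancel, mul_one, inv_mul_cancel_left]
    rw [this]; simp only [mul_assoc, mul_inv_rev, inv_inv]
  have hmem : a₀ ∈ A ⊓ B.map (MulAut.conj (x⁻¹ * x')).toMonoidHom := ⟨ha₀, ha₀'⟩
  rw [h, Subgroup.mem_bot] at hmem
  subst hmem
  simp

/-- **The estrangement step of the proof of Thm 3.7 (iii) (with Comments (6)(b)), CONSUMER half**: under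
`Thm37Hypotheses` (total estrangement), given finite-level data of the chart `c` with the branch-level
Remark 2.2.1 identification `stabBranchPair` (I4), every subgroup `C ≤ π₁^temp` fixing a compatible system
`(w_i; β_i ≠ β'_i)_{i ≥ j₀}` of a vertex with two distinct abutting branches of the finite levels is
TRIVIAL — the hypothesis `hnobp` of `SemiGraph.hstar_of_noFixedBranchPairSystem`, verbatim.
[cite: MochizukiSemiAnbd2006, Thm. 3.7(iii) p.41] -/
theorem noFixedBranchPairSystem_of_isTotallyEstranged (h𝒢 : 𝒢.Thm37Hypotheses) (c : TemperedPiChart 𝒢)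
    {J : Type v} [Preorder J] (level : J → SemiGraph.{u}) (levelAct : ∀ j, c.G →* Aut (level j))
    (levelTrans : ∀ ⦃i j : J⦄, i ≤ j → (level j ⟶ level i))
    (stabBranchPair : ∀ (j₀ : J) (w : ∀ i : {i : J // j₀ ≤ i}, (level i.1).Vertex)
      (β β' : ∀ i : {i : J // j₀ ≤ i}, (level i.1).Branch),
      (∀ i, β i ≠ β' i ∧ (level i.1).abuts (β i) = some (w i) ∧ (level i.1).abuts (β' i) = some (w i)) →
      (∀ ⦃i i' : {i : J // j₀ ≤ i}⦄ (h : i.1 ≤ i'.1), (levelTrans h).vertexMap (w i') = w i ∧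
        (levelTrans h).branchMap (β i') = β i ∧ (levelTrans h).branchMap (β' i') = β' i) →
      ∃ (v : 𝒢.graph.Vertex) (b b' : 𝒢.graph.Branch) (hb : 𝒢.graph.abuts b = some v)
        (hb' : 𝒢.graph.abuts b' = some v) (ψ : 𝒢.Gv v →* c.G) (x x' : 𝒢.Gv v),
        Function.Injective ψ ∧ (b' ≠ b ∨ x⁻¹ * x' ∉ 𝒢.branchSubgroup b v hb) ∧
        ∀ g : c.G, (∀ i, (levelAct i.1 g).hom.vertexMap (w i) = w i ∧
          (levelAct i.1 g).hom.branchMap (β i) = β i ∧ (levelAct i.1 g).hom.branchMap (β' i) = β' i) →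
          g ∈ ((𝒢.branchSubgroup b v hb).map (MulAut.conj x).toMonoidHom).map ψ ⊓
            ((𝒢.branchSubgroup b' v hb').map (MulAut.conj x').toMonoidHom).map ψ)
    (C : Subgroup c.G) :
    ∀ (j₀ : J) (w : ∀ i : {i : J // j₀ ≤ i}, (level i.1).Vertex)
      (β β' : ∀ i : {i : J // j₀ ≤ i}, (level i.1).Branch),
      (∀ i, β i ≠ β' i ∧ (level i.1).abuts (β i) = some (w i) ∧ (level i.1).abuts (β' i) = some (w i)) →
      (∀ ⦃i i' : {i : J // j₀ ≤ i}⦄ (h : i.1 ≤ i'.1), (levelTrans h).vertexMap (w i') = w i ∧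
        (levelTrans h).branchMap (β i') = β i ∧ (levelTrans h).branchMap (β' i') = β' i) →
      (∀ (i : {i : J // j₀ ≤ i}) (γ : C), (levelAct i.1 γ).hom.vertexMap (w i) = w i ∧
        (levelAct i.1 γ).hom.branchMap (β i) = β i ∧ (levelAct i.1 γ).hom.branchMap (β' i) = β' i) →
      C = ⊥ := by
  intro j₀ w β β' hpair hcompat hfix
  obtain ⟨v, b, b', hb, hb', ψ, x, x', hψ, hne, hstab⟩ := stabBranchPair j₀ w β β' hpair hcompat
  -- total estrangement of the edge of `b` at `v`: `Π_b ∩ (x⁻¹x')·Π_{b'}·(x⁻¹x')⁻¹ = 1`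
  have hest := (h𝒢.isTotallyEstranged (𝒢.graph.edgeOf b)).2 b rfl v hb b' hb' (x⁻¹ * x') hne
  have hbot := map_conj_inf_map_conj_eq_bot ψ hψ _ _ x x' hest
  rw [eq_bot_iff]
  intro g hg
  have hmem := hstab g fun i => hfix i ⟨g, hg⟩
  rw [hbot] at hmem
  exact hmem

end ProfiniteSemiGraph

end Literature.AnabelianGeometry.SemiGraphs
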